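import Summits.QuantumFields.YangMills.Theses.BalabanUVNodes
import Summits.QuantumFields.YangMills.Theorems.BalabanUVNodesN27AtRecord13CoPH
import Literature.MathematicalPhysics.QuantumFieldTheory.Balaban1983to89.Node00.Record13DatumKeySepCoPH

/-!
# BalabanUVNodes ∕ N27 = binder B5 AT THE RECORD, XXXVII⁷ (leaf A) — THE ROUTE-FACING FACES OF THE RE-KEYED CRUX K3⁷ `Theses.BalabanUVNodes.SpineGivenEndpointR13SepCoPH`
# (route `route-QuantumFields-BalabanUVNodes` rev 24∕25, **stmt-QuantumFields-20544** (crux r5; plan g73 NEW-IDS-24, dag-lead WORDS-143; text = K3⁷'s under T₇: `θ : Node00.Stage13HParams F 2`, `θ.Provisos₁₃SepCoPH F 2`,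
# `θ.ZhUnity F 2`, `Node00.datumOfRecord₁₃SepCoPH F 2 θ h` — v1.7 = the HISTORY-INDEXED residual 𝐓-weight slot `Zh`, def-T 28T `Node00/Record13SepCoPH.lean` p539169 ✓, director-ym №183∕№186∕№190, FINDING №9) — THE ONLY N27 MODULE THAT TOUCHES THE ITEM'S PROVISO TOKEN: every face applies a
# CoPH-keyed storey (XXXVIᶜᵒᴾᴴ `…N27AtRecord13CoPH`: `Provisos₁₃CoPH`-keyed, datum `datumOfRecord₁₃CoPH`) at `hc := hP.toCore`, the item's datum `datumOfRecord₁₃SepCoPH F 2 θ hP` BEING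
# `datumOfRecord₁₃CoPH F 2 θ hP.toCore` by `rfl` (`datumOfRecord₁₃SepCoPH_eq_coPH`); the item ⟺ its guarded θ-sentence ⟺ B5 `Spine` at RR-2's item-facing CN class `IsRecordOfRecord₁₃CSepCoPHN F 2`
# (`Node00/Record13DatumKeySepCoPH.lean`); the item (one way) from `Spine` at the LARGER CoPH-keyed classes `IsRecordOfRecord₁₃CCoPH ∕ …CCoPHOn Rg ∕ …CCoPHN` — the door for every CoPH-keyed storey —
# hence from `Spine ₅C` ∕ coarser predicates ∕ the cluster statements ∕ the rev-1 stub shape ∕ the guarded keyed faces read off `(θ, hc : Provisos₁₃CoPH)` (BC3 composer) ∕ K5 keyed at the item's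
# tuples.  §§1–4 here; §§5–8 (homes ∕ reading of record) are leaf B `…N27SpineGivenEndpointR13SepCoPHHomes` (400-line rule)
# (cell `pub-ymgap`, HUMAN RULING D-0062 Track A, R134 seat `pub-ymgap-dag-n27-c` (s2); `--kind proof --supports <K3⁷ id> --as helper`; COUNT-NEUTRAL; route-facing LEAF — nothing may import it)

HONEST FRAMING.  COMPOSITE-node re-keying bookkeeping: every K4–K5 stub ∕ reading ∕ edge ∕ `Spine ₅C` premise is a HYPOTHESIS (0∕1); `cr`, `rr`, `SRec`, `RRec`, `Inputs` PARAMETERS; K3⁷ NOT proved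
and NOT claimed; no `Provisos₁₃SepCoPH` inhabitant claimed (K0⁷ open); nothing of Bałaban's asserted; NE7 ∕ NE7b ∕ NE7c NOT PRINTED for d = 4 and NOT PROVED; NO node discharged; counts UNMOVED
(typed 28∕28 · discharged 5∕27, A 5∕28); one finite four-torus programme at fixed `ε` — NOT ℝ⁴, NOT infinite volume, NOT OS, NOT a mass gap, NOT Clay.  0 `def`, 0 `sorry`.  No cite tags.
-/

namespace Summit.QuantumFields.YangMills.Theorems.BalabanUVNodesN27SpineRecord

open Literature.MathematicalPhysics.QuantumFieldTheory.Balaban1983to89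
open Literature.MathematicalPhysics.QuantumFieldTheory.Balaban1983to89.T4Continuum
open T4WeightBudget (RelWeightBound)
open T4IndicatorShell (ShellWeightBound)
open T4ContinuumYM4Torus (ForSmallCouplings)
open Summit.QuantumFields.BalabanUV.T4Continuum.Spine
open Summit.QuantumFields.YangMills.Theses.BalabanUVNodes (SpineGivenEndpointR13SepCoPH)
open YMDAG.UVSplit
open Node00 (Stage13HParams datumOfRecord₁₃SepCoPH datumOfRecord₁₃CoPH IsRecordOfRecord₁₃CCoPH IsRecordOfRecord₁₃CSepCoPH)

/-! ## §1 The item ⟺ its unity-keyed B5 sentence; the item from `Spine ₁₃CCoPH`, from `Spine ₅C`, from any coarser record predicate -/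

section ItemFaces

/-- **THE ITEM IS «B5 AT EVERY UNITY-, SLOT-NONDEGENERATE-, ADMISSIBLE STAGE-13 DATUM OF RECORD OF `SU(2)` DATA»**: its two displayed antecedents (B), END are
B5-under-END's own
(`FiniteEpsData.UnderHypotheses`, definitional) — →: apply at them twice; ←: weaken. [bookkeeping] -/
theorem spineGivenEndpointR13SepCoPH_iff_keyedGuarded :
    SpineGivenEndpointR13SepCoPH ↔ ∀ (F : T4Family) (θ : Stage13HParams F 2) (hP : θ.Provisos₁₃SepCoPH F 2), (θ.ZhUnity F 2 ∧ θ.SlotsNondegenerate₁₃ F 2) → θ.Admissible F 2 →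
      T4ApexHybrid.HybridNE7Under (datumOfRecord₁₃SepCoPH F 2 θ hP) (DagBinding.EndpointExistence (datumOfRecord₁₃SepCoPH F 2 θ hP).C.toB12) := by
  refine ⟨fun h F θ hP hG hθ => ?_, fun h F θ hP hG hθ _ _ => h F θ hP hG hθ⟩
  show (datumOfRecord₁₃SepCoPH F 2 θ hP).UnderHypotheses _ fun g₀ => T4ApexHybrid.StringwiseHybridNE7 ((datumOfRecord₁₃SepCoPH F 2 θ hP).scheme g₀)
  intro hB hEnd
  exact h F θ hP hG hθ hB hEnd hB hEnd

/-- **`Spine ₁₃CCoPH` AT `N = 2` GIVES THE ITEM** (XXXVIᶜᵒᴾᴴ `keyedGuarded₁₃CoPH_of_spine_rec13CCoPH` at the item's guard, applied at `hc := hP.toCore` — the item's datum `datumOfRecord₁₃SepCoPH F 2 θ hP` IS `datumOfRecord₁₃CoPH F 2 θ hP.toCore` (`rfl`); B5 at EVERY CoPH-keyed record is stronger: the Core class contains every SepCoPH tuple). [bookkeeping] -/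
theorem spineGivenEndpointR13SepCoPH_of_spine_rec13CCoPH (h : Spine (N := 2) fun F D w => IsRecordOfRecord₁₃CCoPH F 2 D w) : SpineGivenEndpointR13SepCoPH :=
  fun F θ hP hG hθ hB hE =>
    keyedGuarded₁₃CoPH_of_spine_rec13CCoPH (fun θ => θ.ZhUnity _ 2 ∧ θ.SlotsNondegenerate₁₃ _ 2) h F θ hP.toCore hG hθ hB hE

/-- **THE ITEM FROM `Spine` AT THE STAGE-5 RECORD PREDICATE** (`N = 2`; XXXVIᶜᵒᴾᴴ `spine_rec13CCoPH_of_spine_rec5C`, shadow road).  The premise has NO producer today. [bookkeeping] -/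
theorem spineGivenEndpointR13SepCoPH_of_spine_rec5C (h₅ : Spine (N := 2) fun F D w => Node00.IsRecordOfRecord₅C F 2 D w) : SpineGivenEndpointR13SepCoPH :=
  spineGivenEndpointR13SepCoPH_of_spine_rec13CCoPH (spine_rec13CCoPH_of_spine_rec5C h₅)

/-- The item from B5 at ANY record predicate coarser than ₅C (`N = 2`; XXXVIᶜᵒᴾᴴ `spine_rec13CCoPH_of_coarser`, tower road). [bookkeeping] -/
theorem spineGivenEndpointR13SepCoPH_of_coarser {Rec : RecordPred 2}
    (hle : ∀ (F : T4Family) (D : Datum F 2) (w : DagBinding.WorldP), Node00.IsRecordOfRecord₅C F 2 D w → Rec F D w) (h : Spine Rec) :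
    SpineGivenEndpointR13SepCoPH :=
  spineGivenEndpointR13SepCoPH_of_spine_rec13CCoPH (spine_rec13CCoPH_of_coarser hle h)

end ItemFaces

/-! ## §2 The knits: from the cluster statements, from the rev-1 stub shape at parametric carrier records, from the unity-guarded keyed faces (the BC3 composer) -/

section Knits

variable (Inputs : InputsPred 2) (SRec : SpineRecordPred 2) (RRec : RateRecordPred 2)

/-- **THE ITEM FROM THE TWO CLUSTER STATEMENTS AT THE STAGE-13 RECORD** (`N = 2`): K4's hook `SpineRates ₁₃CSep Inputs` and K5 `SpineMatching ₁₃CSep Inputs` (the route module's glue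
`YMDAG.UVSplit.B5_at_record` BY NAME). [bookkeeping] -/
theorem spineGivenEndpointR13SepCoPH_of_spineRates_spineMatching (h4 : SpineRates (fun F D w => IsRecordOfRecord₁₃CCoPH F 2 D w) Inputs)
    (h5 : SpineMatching (fun F D w => IsRecordOfRecord₁₃CCoPH F 2 D w) Inputs) : SpineGivenEndpointR13SepCoPH :=
  spineGivenEndpointR13SepCoPH_of_spine_rec13CCoPH (B5_at_record _ Inputs h4 h5)

/-- **THE ITEM FROM THE SEVEN K4 STUBS AND THE REV-1 K5 AT PARAMETRIC CARRIER RECORDS** (`N = 2`; XIV `spine_of_rateStubs_coreEdge` at ₁₃CSep): R00x · N14–N18 · N22 at `RRec` · N27x · N20 ·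
N21 at `SRec` · the N19′ ∃δ-edge. [bookkeeping] -/
theorem spineGivenEndpointR13SepCoPH_of_rateStubs_coreEdge
    (hx : S_R00x (fun F D w => IsRecordOfRecord₁₃CCoPH F 2 D w) RRec) (h14 : S_N14 RRec) (h15 : S_N15 RRec) (h16 : S_N16 RRec)
    (h17 : S_N17 RRec) (h18 : S_N18 RRec) (h22 : S_N22 RRec) (hx' : S_N27x (fun F D w => IsRecordOfRecord₁₃CCoPH F 2 D w) SRec)
    (h20 : S_N20 SRec) (h21 : S_N21 SRec)
    (h19 : ∀ (F : T4Family) (D : Datum F 2) (g₀ : ℕ → ℝ) (os : List (ULoop F)) (S : SpineCarriers) (R : RateCarriers 2),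
      SRec F D g₀ os S → RRec F D g₀ os R → RatesAt D R → letI := S.dec
        ∃ δ : ℕ → ℝ, NE7.Core S.l₀ S.vol S.T S.Bad (fun K t τ => S.A K t τ - S.shA K t τ) (fun K t τ => S.B K t τ - S.shB K t τ) δ ∧
          Summable δ) :
    SpineGivenEndpointR13SepCoPH :=
  spineGivenEndpointR13SepCoPH_of_spine_rec13CCoPH (spine_of_rateStubs_coreEdge _ SRec RRec hx h14 h15 h16 h17 h18 h22 hx' h20 h21 h19)

variable (cr : (F : T4Family) → (θ : Stage13HParams F 2) → θ.Provisos₁₃CoPH F 2 → (ℕ → ℝ) → List (ULoop F) → SpineCarriers)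
  (rr : (F : T4Family) → (θ : Stage13HParams F 2) → θ.Provisos₁₃CoPH F 2 → (ℕ → ℝ) → List (ULoop F) → RateCarriers 2)

/-- **THE BC3 COMPOSER: THE ITEM FROM THE CHILDREN'S ESTIMATES KEYED AT THE STAGE-13 TUPLES, ASKED ONLY ON THE GUARDED CLASS** (`N = 2`; XXXVI
`keyedGuarded₁₃CoPH_of_keyedFaces` = XXIVb `forall_guarded_of_keyedFaces` at the Stage-13 key with guard `G θ := θ.ZhUnity F 2 ∧ θ.SlotsNondegenerate₁₃ F 2` — print's partition of unity and
non-degenerate present slots, director LINES №99 (2) ∕ №108 ∕ №118; the unbundled form of plan's registered composition `SpineGivenEndpointR13SepCoPH_of` (K3⁷ skeleton twin), guard-restricted): for readings `cr` ∕ `rr` off `(θ, h)` — at every Stage-13 θ with provisos satisfying the guard `θ.ZhUnity F 2 ∧ θ.SlotsNondegenerate₁₃ F 2` and `θ.Admissible F 2`, every `g₀`, `os`: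
N20 `RelWeightBound` and N21 `ShellWeightBound` at `cr F θ h g₀ os` · K4's six rates `RatesAt (datumOfRecord₁₃CoPH F 2 θ h) (rr F θ h g₀ os)` · the same-tuple N19′ ∃δ-edge · the keyed
extraction clause (positivity + E1∕E2 under (B), END, small tuned couplings) ⇒ `SpineGivenEndpointR13SepCoPH`.  Every hypothesis 0∕1 today; `cr`, `rr` PARAMETERS. [bookkeeping] -/
theorem spineGivenEndpointR13SepCoPH_of_keyedFaces
    (h20 : ∀ (F : T4Family) (θ : Stage13HParams F 2) (hP : θ.Provisos₁₃CoPH F 2), (θ.ZhUnity F 2 ∧ θ.SlotsNondegenerate₁₃ F 2) → θ.Admissible F 2 →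
      ∀ (g₀ : ℕ → ℝ) (os : List (ULoop F)),
      RelWeightBound (cr F θ hP g₀ os).l₀ (cr F θ hP g₀ os).T (cr F θ hP g₀ os).A (cr F θ hP g₀ os).B (cr F θ hP g₀ os).Bad (cr F θ hP g₀ os).W)
    (h21 : ∀ (F : T4Family) (θ : Stage13HParams F 2) (hP : θ.Provisos₁₃CoPH F 2), (θ.ZhUnity F 2 ∧ θ.SlotsNondegenerate₁₃ F 2) → θ.Admissible F 2 →
      ∀ (g₀ : ℕ → ℝ) (os : List (ULoop F)),
      ShellWeightBound (cr F θ hP g₀ os).l₀ (cr F θ hP g₀ os).T (cr F θ hP g₀ os).A (cr F θ hP g₀ os).B (cr F θ hP g₀ os).shA (cr F θ hP g₀ os).shB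
        (cr F θ hP g₀ os).Wsh)
    (hrates : ∀ (F : T4Family) (θ : Stage13HParams F 2) (hP : θ.Provisos₁₃CoPH F 2), (θ.ZhUnity F 2 ∧ θ.SlotsNondegenerate₁₃ F 2) → θ.Admissible F 2 →
      ∀ (g₀ : ℕ → ℝ) (os : List (ULoop F)), RatesAt (datumOfRecord₁₃CoPH F 2 θ hP) (rr F θ hP g₀ os))
    (h19 : ∀ (F : T4Family) (θ : Stage13HParams F 2) (hP : θ.Provisos₁₃CoPH F 2), (θ.ZhUnity F 2 ∧ θ.SlotsNondegenerate₁₃ F 2) → θ.Admissible F 2 →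
      ∀ (g₀ : ℕ → ℝ) (os : List (ULoop F)),
      RatesAt (datumOfRecord₁₃CoPH F 2 θ hP) (rr F θ hP g₀ os) → letI := (cr F θ hP g₀ os).dec
        ∃ δ : ℕ → ℝ, NE7.Core (cr F θ hP g₀ os).l₀ (cr F θ hP g₀ os).vol (cr F θ hP g₀ os).T (cr F θ hP g₀ os).Bad
          (fun K t τ => (cr F θ hP g₀ os).A K t τ - (cr F θ hP g₀ os).shA K t τ) (fun K t τ => (cr F θ hP g₀ os).B K t τ - (cr F θ hP g₀ os).shB K t τ) δ ∧
          Summable δ)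
    (hx : ∀ (F : T4Family) (θ : Stage13HParams F 2) (hP : θ.Provisos₁₃CoPH F 2), (θ.ZhUnity F 2 ∧ θ.SlotsNondegenerate₁₃ F 2) → θ.Admissible F 2 →
      B16.EndStatementBPrinted (datumOfRecord₁₃CoPH F 2 θ hP).C → DagBinding.EndpointExistence (datumOfRecord₁₃CoPH F 2 θ hP).C.toB12 →
        ForSmallCouplings (datumOfRecord₁₃CoPH F 2 θ hP) fun g₀ => ∀ os : List (ULoop F),
          0 < (cr F θ hP g₀ os).l₀ ∧ 0 < (cr F θ hP g₀ os).vol ∧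
          (∀ (K : ℕ) (t : ℝ), |t| ≤ (cr F θ hP g₀ os).l₀ →
            T4GenFunBounds.schemeZ ((datumOfRecord₁₃CoPH F 2 θ hP).scheme g₀) os ((cr F θ hP g₀ os).K₀ + K) t =
              ∑ τ ∈ (cr F θ hP g₀ os).T K, (cr F θ hP g₀ os).A K t τ) ∧
          (∀ (K : ℕ) (t : ℝ), |t| ≤ (cr F θ hP g₀ os).l₀ →
            T4GenFunBounds.schemeZ ((datumOfRecord₁₃CoPH F 2 θ hP).scheme g₀) os ((cr F θ hP g₀ os).K₀ + K + 1) t =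
              ∑ τ ∈ (cr F θ hP g₀ os).T K, (cr F θ hP g₀ os).B K t τ)) :
    SpineGivenEndpointR13SepCoPH :=
  fun F θ hP hG hθ _ _ =>
    keyedGuarded₁₃CoPH_of_keyedFaces cr rr (fun θ => θ.ZhUnity _ 2 ∧ θ.SlotsNondegenerate₁₃ _ 2) h20 h21 hrates h19 hx F θ hP.toCore hG hθ

/-- **THE ITEM FROM THE STUB INSTANCES OF A DIVIDED STAGE-13 CARRIER HOME AND THE PAIR-FORM N19′ EDGE** (`N = 2`; XXXVIᶜᵒᴾᴴ `spine_rec13CCoPH_of_rateStubs_twoKeys₁₃CoPH`; the stubs are asked at EVERY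
admissible θ — stronger than the guarded class needs). [bookkeeping] -/
theorem spineGivenEndpointR13SepCoPH_of_rateStubs_twoKeys₁₃CoPH
    (hkeyS : ∀ (F : T4Family) (D : Datum F 2) (g₀ : ℕ → ℝ) (os : List (ULoop F)) (S : SpineCarriers), SRec F D g₀ os S ↔
      ∃ (θ : Stage13HParams F 2) (hP : θ.Provisos₁₃CoPH F 2), θ.Admissible F 2 ∧ D = datumOfRecord₁₃CoPH F 2 θ hP ∧ S = cr F θ hP g₀ os)
    (hkeyR : ∀ (F : T4Family) (D : Datum F 2) (g₀ : ℕ → ℝ) (os : List (ULoop F)) (R : RateCarriers 2), RRec F D g₀ os R ↔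
      ∃ (θ : Stage13HParams F 2) (hP : θ.Provisos₁₃CoPH F 2), θ.Admissible F 2 ∧ D = datumOfRecord₁₃CoPH F 2 θ hP ∧ R = rr F θ hP g₀ os)
    (hx : S_R00x (fun F D w => IsRecordOfRecord₁₃CCoPH F 2 D w) RRec) (h14 : S_N14 RRec) (h15 : S_N15 RRec) (h16 : S_N16 RRec) (h17 : S_N17 RRec)
    (h18 : S_N18 RRec) (h22 : S_N22 RRec) (hx' : S_N27x (fun F D w => IsRecordOfRecord₁₃CCoPH F 2 D w) SRec) (h20 : S_N20 SRec) (h21 : S_N21 SRec)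
    (h19₂ : ∀ (F : T4Family) (θ : Stage13HParams F 2) (hP : θ.Provisos₁₃CoPH F 2) (θ' : Stage13HParams F 2) (hP' : θ'.Provisos₁₃CoPH F 2),
      θ.Admissible F 2 → θ'.Admissible F 2 → datumOfRecord₁₃CoPH F 2 θ' hP' = datumOfRecord₁₃CoPH F 2 θ hP → ∀ (g₀ : ℕ → ℝ) (os : List (ULoop F)),
        RatesAt (datumOfRecord₁₃CoPH F 2 θ hP) (rr F θ' hP' g₀ os) → letI := (cr F θ hP g₀ os).dec
          ∃ δ : ℕ → ℝ, NE7.Core (cr F θ hP g₀ os).l₀ (cr F θ hP g₀ os).vol (cr F θ hP g₀ os).T (cr F θ hP g₀ os).Bad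
            (fun K t τ => (cr F θ hP g₀ os).A K t τ - (cr F θ hP g₀ os).shA K t τ) (fun K t τ => (cr F θ hP g₀ os).B K t τ - (cr F θ hP g₀ os).shB K t τ) δ ∧
            Summable δ) :
    SpineGivenEndpointR13SepCoPH :=
  spineGivenEndpointR13SepCoPH_of_spine_rec13CCoPH
    (spine_rec13CCoPH_of_rateStubs_twoKeys₁₃CoPH cr rr SRec RRec hkeyS hkeyR hx h14 h15 h16 h17 h18 h22 hx' h20 h21 h19₂)

end Knits

/-! ## §3 The cluster-level keyed faces: K3⁷ from K5 «SpineDatum» (and K4's hook) READ AT THE GUARDED STAGE-13 TUPLES — the shape `closes` consumes -/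

section KeyedClusters

variable (Inputs : InputsPred 2)

/-- **THE ITEM FROM THE K5 CLUSTER STATEMENT KEYED AT THE GUARDED STAGE-13 TUPLES** (`N = 2`): if at every Stage-13 θ with provisos, `θ.ZhUnity F 2`, `θ.SlotsNondegenerate₁₃ F 2`,
`θ.Admissible F 2`, under (B) and END at the datum of record, for all small tuned `g₀` and EVERY loop string the per-string SPINE DATUM `YMDAG.UVSplit.SpineDatum` holds (N20 ∧ N21 ∧ N19-on-cores
∧ budget ∧ `Summable δ` ∧ E1∕E2 at explicit carriers — R420's unguarded K5), then `SpineGivenEndpointR13SepCoPH` — per string by the route module's `stringHybridNE7_of_spineDatum`.  No record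
predicate, no world. [bookkeeping] -/
theorem spineGivenEndpointR13SepCoPH_of_keyedSpineDatum
    (h5 : ∀ (F : T4Family) (θ : Stage13HParams F 2) (hP : θ.Provisos₁₃SepCoPH F 2), (θ.ZhUnity F 2 ∧ θ.SlotsNondegenerate₁₃ F 2) → θ.Admissible F 2 →
      B16.EndStatementBPrinted (datumOfRecord₁₃SepCoPH F 2 θ hP).C → DagBinding.EndpointExistence (datumOfRecord₁₃SepCoPH F 2 θ hP).C.toB12 →
        ForSmallCouplings (datumOfRecord₁₃SepCoPH F 2 θ hP) fun g₀ => ∀ os : List (ULoop F), SpineDatum (datumOfRecord₁₃SepCoPH F 2 θ hP) g₀ os) :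
    SpineGivenEndpointR13SepCoPH := by
  intro F θ hP hG hθ _ _
  show (datumOfRecord₁₃SepCoPH F 2 θ hP).UnderHypotheses _ fun g₀ => T4ApexHybrid.StringwiseHybridNE7 ((datumOfRecord₁₃SepCoPH F 2 θ hP).scheme g₀)
  intro hB hEnd
  exact (h5 F θ hP hG hθ hB hEnd).mono fun g₀ hg => stringHybridNE7_of_spineDatum _ g₀ hg

/-- **THE ITEM FROM K4's HOOK AND K5 BOTH KEYED AT THE GUARDED STAGE-13 TUPLES** (`N = 2`; the route glue `B5_at_record`'s mechanism, θ-keyed): K4 «for all small tuned `g₀`, every `os`: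
`Inputs`» and K5 «… `Inputs → SpineDatum`» at every guarded θ ⇒ `SpineGivenEndpointR13SepCoPH` (`ForSmallCouplings.and`, modus ponens per string). [bookkeeping] -/
theorem spineGivenEndpointR13SepCoPH_of_keyedSpineRates_spineMatching
    (h4 : ∀ (F : T4Family) (θ : Stage13HParams F 2) (hP : θ.Provisos₁₃SepCoPH F 2), (θ.ZhUnity F 2 ∧ θ.SlotsNondegenerate₁₃ F 2) → θ.Admissible F 2 →
      B16.EndStatementBPrinted (datumOfRecord₁₃SepCoPH F 2 θ hP).C → DagBinding.EndpointExistence (datumOfRecord₁₃SepCoPH F 2 θ hP).C.toB12 →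
        ForSmallCouplings (datumOfRecord₁₃SepCoPH F 2 θ hP) fun g₀ => ∀ os : List (ULoop F), Inputs F (datumOfRecord₁₃SepCoPH F 2 θ hP) g₀ os)
    (h5 : ∀ (F : T4Family) (θ : Stage13HParams F 2) (hP : θ.Provisos₁₃SepCoPH F 2), (θ.ZhUnity F 2 ∧ θ.SlotsNondegenerate₁₃ F 2) → θ.Admissible F 2 →
      B16.EndStatementBPrinted (datumOfRecord₁₃SepCoPH F 2 θ hP).C → DagBinding.EndpointExistence (datumOfRecord₁₃SepCoPH F 2 θ hP).C.toB12 →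
        ForSmallCouplings (datumOfRecord₁₃SepCoPH F 2 θ hP) fun g₀ => ∀ os : List (ULoop F),
          Inputs F (datumOfRecord₁₃SepCoPH F 2 θ hP) g₀ os → SpineDatum (datumOfRecord₁₃SepCoPH F 2 θ hP) g₀ os) :
    SpineGivenEndpointR13SepCoPH := by
  intro F θ hP hG hθ _ _
  show (datumOfRecord₁₃SepCoPH F 2 θ hP).UnderHypotheses _ fun g₀ => T4ApexHybrid.StringwiseHybridNE7 ((datumOfRecord₁₃SepCoPH F 2 θ hP).scheme g₀)
  intro hB hEnd
  exact ((h4 F θ hP hG hθ hB hEnd).and (h5 F θ hP hG hθ hB hEnd)).mono fun g₀ hg =>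
    stringHybridNE7_of_spineDatum _ g₀ fun os => hg.2 os (hg.1 os)

end KeyedClusters

/-! ## §4 THE ITEM IS «B5 AT node00-def-RR-2's CN RECORD CLASS» (`Node00.IsRecordOfRecord₁₃CSepCoPHN F 2` = the Stage-13 records whose parameter carries print's partition of unity AND
non-degenerate present slots, `Node00/Record13DatumKeySep` §7; module XXXVIᶜᵒᴾᴴ §6) -/

section RegimeRecord

/-- **THE ITEM ⟺ B5 `Spine` AT THE CN RECORD CLASS OF RECORD** (`N = 2`): `SpineGivenEndpointR13SepCoPH` holds iff `T4ApexHybrid.HybridNE7Under D END` at EVERY Stage-13 record `(D, w)`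
realised by an admissible tuple with provisos satisfying `θ.ZhUnity F 2 ∧ θ.SlotsNondegenerate₁₃ F 2` (§1 `spineGivenEndpointR13SepCoPH_iff_keyedGuarded` ∘ RR-2's junction `forall_isRecordOfRecord₁₃CSepCoPHN_iff`,
`Node00/Record13DatumKeySepCoPH.lean`).  So every record-level road of this package (XII∕XIV∕XXIV∕XXXVIᶜᵒᴾᴴ) run at `Rec := IsRecordOfRecord₁₃CSepCoPHN F 2` concludes the
item EXACTLY — neither the stronger `Spine ₁₃CCoPH` nor a weakening; e.g. XXXVIᶜᵒᴾᴴ `spine_rec13CSepOn_of_keyedFaces` at `Rg := Node00.unityNondeg₁₃H 2`. [bookkeeping] -/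
theorem spineGivenEndpointR13SepCoPH_iff_spine_rec13CSepCoPHN :
    SpineGivenEndpointR13SepCoPH ↔ Spine (N := 2) fun F D w => Node00.IsRecordOfRecord₁₃CSepCoPHN F 2 D w :=
  spineGivenEndpointR13SepCoPH_iff_keyedGuarded.trans
    (forall_congr' fun F => Node00.forall_isRecordOfRecord₁₃CSepCoPHN_iff F 2 fun D =>
      T4ApexHybrid.HybridNE7Under D (DagBinding.EndpointExistence D.C.toB12)).symm

/-- **THE ITEM FROM B5 AT THE RECORD CLASS OF ANY REGIME CONTAINING THE GUARD** (`N = 2`; RR-2 `IsRecordOfRecord₁₃CSepCoPHOn.mono` + XII `spine_antitone`): e.g. the trivial regime (`Spine ₁₃CCoPH`, §1), the unity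
regime `θ.ZhUnity F 2` alone, or the guard itself. [bookkeeping] -/
theorem spineGivenEndpointR13SepCoPH_of_spine_rec13CSepCoPHOn {Rg : (F : T4Family) → Stage13HParams F 2 → Prop}
    (hle : ∀ (F : T4Family) (θ : Stage13HParams F 2), (θ.ZhUnity F 2 ∧ θ.SlotsNondegenerate₁₃ F 2) → Rg F θ)
    (h : Spine (N := 2) fun F D w => Node00.IsRecordOfRecord₁₃CSepCoPHOn F 2 Rg D w) : SpineGivenEndpointR13SepCoPH :=
  spineGivenEndpointR13SepCoPH_iff_spine_rec13CSepCoPHN.mpr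
    (spine_antitone (fun _ _ _ hR => Node00.IsRecordOfRecord₁₃CSepCoPHOn.mono hle hR) h)

/-- **THE ITEM FROM B5 AT RR-2's CoPH-KEYED CN RECORD CLASS** (ONE-WAY; `N = 2`; XXXVIᶜᵒᴾᴴ `spine_rec13CCoPHN_iff_forall_guarded` instantiated at `hc := hP.toCore`): the CoPH-keyed class
`Node00.IsRecordOfRecord₁₃CCoPHN F 2` (records realised by an admissible tuple with CORE provisos in the guard) CONTAINS every record of an item tuple (`Provisos₁₃SepCoPH.toCore`, datum `rfl`),
so `Spine` there gives the item; the converse fails (the Core class is larger).  This is the door through which every CoPH-keyed storey (XXXVIIIᶜᵒᴾᴴ∕XXXIXᶜᵒᴾᴴ∕XLᶜᵒᴾᴴ–XLIIᶜᵒᴾᴴ) reaches K3. [bookkeeping] -/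
theorem spineGivenEndpointR13SepCoPH_of_spine_rec13CCoPHN (h : Spine (N := 2) fun F D w => Node00.IsRecordOfRecord₁₃CCoPHN F 2 D w) : SpineGivenEndpointR13SepCoPH :=
  fun F θ hP hG hθ _ _ => (spine_rec13CCoPHN_iff_forall_guarded (N := 2)).mp h F θ hP.toCore hG hθ

/-- **THE ITEM FROM B5 AT THE CoPH-KEYED RECORD CLASS OF ANY REGIME CONTAINING THE GUARD** (ONE-WAY; `N = 2`; XXXVIᶜᵒᴾᴴ `spine_rec13CCoPHOn_iff_forall_guarded` at `hc := hP.toCore`). [bookkeeping] -/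
theorem spineGivenEndpointR13SepCoPH_of_spine_rec13CCoPHOn {Rg : (F : T4Family) → Stage13HParams F 2 → Prop}
    (hle : ∀ (F : T4Family) (θ : Stage13HParams F 2), (θ.ZhUnity F 2 ∧ θ.SlotsNondegenerate₁₃ F 2) → Rg F θ)
    (h : Spine (N := 2) fun F D w => Node00.IsRecordOfRecord₁₃CCoPHOn F 2 Rg D w) : SpineGivenEndpointR13SepCoPH :=
  fun F θ hP hG hθ _ _ => (spine_rec13CCoPHOn_iff_forall_guarded Rg).mp h F θ hP.toCore (hle F θ hG) hθ

end RegimeRecord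


end Summit.QuantumFields.YangMills.Theorems.BalabanUVNodesN27SpineRecord
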